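import Summits.MatrixMultiplication.OmegaCensus.STPPVosperSlackOneLawCard2
import Summits.MatrixMultiplication.OmegaCensus.STPPVosperSlackOneKillsZ59
import Summits.MatrixMultiplication.OmegaCensus.STPPVosperSlackOneKillsB2Z59
import Summits.MatrixMultiplication.OmegaCensus.STPP222SqSymmetry
import Summits.MatrixMultiplication.OmegaCensus.STPPDisjointPacking

/-!
# ω-census (abelian STPP census): the g30 `ℤ₅₉` kills restated with the Hamidoune–Rødseth hypothesis restricted to `|S| ∈ {3, 4}` (kernel)

HONEST FRAMING (pub-omega census; verbatim): lottery ticket; floor = certified bounds/negative ranges.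
Census STRUCTURE (seat pub-omega-stpp-1 gen 30, 2026-08-28), family (b2).  Bookkeeping companions of the `…_of_hamidouneRodseth` kills: the same leaves, same
readings and tables, but the hypothesis is `HamidouneRodsethCard 3` and/or `HamidouneRodsethCard 4` (the published theorem for three- resp. four-element sets `S`
only; `STPPVosperSlackOneLawCard.lean`).  So the census can record per leaf that Hamidoune–Rødseth for `|S| = 3` (resp. `4`) is the exact upstream item.  Still
CONDITIONAL; nothing here is progress on `ω`.

References: Y. O. Hamidoune, Ø. J. Rødseth, Acta Arith. 92 (2000) 251–262; A. G. Vosper, J. London Math. Soc. 31 (1956); M. B. Nathanson, GTM 165,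
Thm 2.7; H. Cohn, R. Kleinberg, B. Szegedy, C. Umans, FOCS 2005 (arXiv:math/0511460), Def. 5.1.
-/

open Finset
open scoped Pointwise

namespace Summit.MatrixMultiplication.OmegaCensus.CubeNB

open Literature.Computability.AlgebraicComplexity
open Literature.Combinatorics.Additive
open Summit.MatrixMultiplication.OmegaCensus.STPPKneser

section Kills

/-- **`{(1,1,1),(2,4,4),(3,3,3)}` has no STPP family in `ℤ/59ℤ`, PROVIDED the Hamidoune–Rødseth theorem for the stated cardinalities only** (enlarged-target
slack-1 law, reading `(b,c,a)`, block `(4, 4, 2)`: `(z, b, vol, a, L) = (10, 4, 32, 4, 10)`, tables `(45,13,4)`, α `(46,15,4)`, β `(46,13,4)`,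
target `{0, 1, 58, 2, 57, 3, 56, 30, 29, 20, 39}`). [cite: CohnKleinbergSzegedyUmans2005, Def. 5.1] [cite: HamidouneRodseth2000, main theorem (§1, p. 252)] [cite: Nathanson1996, Thm 2.7] -/
theorem no_isSTPP_zmod59_111_244_333_of_hrCard4 (h4 : HamidouneRodsethCard 4)
    (A B C : Fin 3 → Finset (ZMod 59)) (hS : IsSTPP A B C)
    (hA : ∀ i, #(A i) = ![1, 2, 3] i) (hB : ∀ i, #(B i) = ![1, 4, 3] i) (hC : ∀ i, #(C i) = ![1, 4, 3] i) :
    False := by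
  haveI : Fact (Nat.Prime 59) := ⟨by norm_num⟩
  have hAne : ∀ i, (A i).Nonempty := fun i => card_pos.1 (by rw [hA]; fin_cases i <;> simp)
  have hBne : ∀ i, (B i).Nonempty := fun i => card_pos.1 (by rw [hB]; fin_cases i <;> simp)
  have hCne : ∀ i, (C i).Nonempty := fun i => card_pos.1 (by rw [hC]; fin_cases i <;> simp)
  have hS' : IsSTPP B C A := stpp_rotate hS
  have e1 : (univ : Finset (Fin 3)).erase 1 = {0, 2} := by decide
  have hz : ∑ k ∈ (univ : Finset (Fin 3)).erase 1, #(B k) * #(A k) = 10 := by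
    rw [e1, Finset.sum_pair (by decide)]; simp [hB, hA]
  have hL : ∑ k ∈ (univ : Finset (Fin 3)).erase 1, #(C k) * #(A k) = 10 := by
    rw [e1, Finset.sum_pair (by decide)]; simp [hC, hA]
  have ha : #(B 1) = 4 := by rw [hB]; simp
  have hb : #(C 1) = 4 := by rw [hC]; simp
  have hvol : #(B 1) * #(C 1) * #(A 1) = 32 := by rw [hA, hB, hC]; simp
  exact no_isSTPP_of_slack_one_tables_prime_card h4 h4 B C A hS' hBne hCne hAne 1 ⟨0, by decide⟩ ha hb hvol hz hL
    (by norm_num) (by norm_num) (by norm_num) (by norm_num) (by norm_num) (m := 13) (n := 45) rfl rfl target59_a4_b4 table59_45_13_4_a4b4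
    tableAlpha59_46_15_4_a4b4 tableBeta59_46_13_4_a4b4

/-- **`{(1,2,3),(3,3,3),(3,3,3)}` has no STPP family in `ℤ/59ℤ`, PROVIDED the Hamidoune–Rødseth theorem for the stated cardinalities only** (enlarged-target
slack-1 law, reading `(a,b,c)`, block `(3, 3, 3)`: `(z, b, vol, a, L) = (12, 3, 27, 3, 15)`, tables `(44,17,3)`, α `(45,19,3)`, β `(45,17,3)`,
target `{0, 1, 58, 2, 57, 30, 29}`). [cite: CohnKleinbergSzegedyUmans2005, Def. 5.1] [cite: HamidouneRodseth2000, main theorem (§1, p. 252)] [cite: Nathanson1996, Thm 2.7] -/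
theorem no_isSTPP_zmod59_123_333_333_of_hrCard3 (h3 : HamidouneRodsethCard 3)
    (A B C : Fin 3 → Finset (ZMod 59)) (hS : IsSTPP A B C)
    (hA : ∀ i, #(A i) = ![1, 3, 3] i) (hB : ∀ i, #(B i) = ![2, 3, 3] i) (hC : ∀ i, #(C i) = ![3, 3, 3] i) :
    False := by
  haveI : Fact (Nat.Prime 59) := ⟨by norm_num⟩
  have hAne : ∀ i, (A i).Nonempty := fun i => card_pos.1 (by rw [hA]; fin_cases i <;> simp)
  have hBne : ∀ i, (B i).Nonempty := fun i => card_pos.1 (by rw [hB]; fin_cases i <;> simp)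
  have hCne : ∀ i, (C i).Nonempty := fun i => card_pos.1 (by rw [hC]; fin_cases i <;> simp)
  have e1 : (univ : Finset (Fin 3)).erase 1 = {0, 2} := by decide
  have hz : ∑ k ∈ (univ : Finset (Fin 3)).erase 1, #(A k) * #(C k) = 12 := by
    rw [e1, Finset.sum_pair (by decide)]; simp [hA, hC]
  have hL : ∑ k ∈ (univ : Finset (Fin 3)).erase 1, #(B k) * #(C k) = 15 := by
    rw [e1, Finset.sum_pair (by decide)]; simp [hB, hC]
  have ha : #(A 1) = 3 := by rw [hA]; simp
  have hb : #(B 1) = 3 := by rw [hB]; simp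
  have hvol : #(A 1) * #(B 1) * #(C 1) = 27 := by rw [hA, hB, hC]; simp
  exact no_isSTPP_of_slack_one_tables_prime_card h3 h3 A B C hS hAne hBne hCne 1 ⟨0, by decide⟩ ha hb hvol hz hL (by norm_num) (by norm_num)
    (by norm_num) (by norm_num) (by norm_num) (m := 17) (n := 44) rfl rfl target59_a3_b3 table59_44_17_3_a3b3 tableAlpha59_45_19_3_a3b3
    tableBeta59_45_17_3_a3b3

/-- **`{(1,1,2),(2,2,1),(3,3,3),(3,3,3)}` has no STPP family in `ℤ/59ℤ`, PROVIDED the Hamidoune–Rødseth theorem for the stated cardinalities only** (enlarged-target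
slack-1 law, reading `(a,c,b) = (−A,−C,−B)`, block `(3, 3, 3)`: `(z, b, vol, a, L) = (14, 3, 27, 3, 13)`, tables `(42,15,3)`, α `(43,17,3)`, β `(43,15,3)`,
target `{0, 1, 58, 2, 57, 30, 29}`). [cite: CohnKleinbergSzegedyUmans2005, Def. 5.1] [cite: HamidouneRodseth2000, main theorem (§1, p. 252)] [cite: Nathanson1996, Thm 2.7] -/
theorem no_isSTPP_zmod59_112_221_333_333_of_hrCard3 (h3 : HamidouneRodsethCard 3)
    (A B C : Fin 4 → Finset (ZMod 59)) (hS : IsSTPP A B C)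
    (hA : ∀ i, #(A i) = ![1, 2, 3, 3] i) (hB : ∀ i, #(B i) = ![1, 2, 3, 3] i) (hC : ∀ i, #(C i) = ![2, 1, 3, 3] i) :
    False := by
  haveI : Fact (Nat.Prime 59) := ⟨by norm_num⟩
  have hAne : ∀ i, (A i).Nonempty := fun i => card_pos.1 (by rw [hA]; fin_cases i <;> simp)
  have hBne : ∀ i, (B i).Nonempty := fun i => card_pos.1 (by rw [hB]; fin_cases i <;> simp)
  have hCne : ∀ i, (C i).Nonempty := fun i => card_pos.1 (by rw [hC]; fin_cases i <;> simp)
  -- the family (−A, −C, −B)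
  set A' : Fin 4 → Finset (ZMod 59) := fun t => (A t).image Neg.neg with hA'
  set B' : Fin 4 → Finset (ZMod 59) := fun t => (C t).image Neg.neg with hB'
  set C' : Fin 4 → Finset (ZMod 59) := fun t => (B t).image Neg.neg with hC'
  have hS' : IsSTPP A' B' C' := STPP222SqNeg.isSTPP_negSwap hS
  have hcA' : ∀ t, #(A' t) = #(A t) := fun t => Finset.card_image_of_injective _ neg_injective
  have hcB' : ∀ t, #(B' t) = #(C t) := fun t => Finset.card_image_of_injective _ neg_injective
  have hcC' : ∀ t, #(C' t) = #(B t) := fun t => Finset.card_image_of_injective _ neg_injective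
  have hAne' : ∀ t, (A' t).Nonempty := fun t => (hAne t).image _
  have hBne' : ∀ t, (B' t).Nonempty := fun t => (hCne t).image _
  have hCne' : ∀ t, (C' t).Nonempty := fun t => (hBne t).image _
  have e2 : (univ : Finset (Fin 4)).erase 2 = {0, 1, 3} := by decide
  have hz : ∑ k ∈ (univ : Finset (Fin 4)).erase 2, #(A' k) * #(C' k) = 14 := by
    rw [e2]; simp [Finset.sum_insert, hcA', hcC', hA, hB]
  have hL : ∑ k ∈ (univ : Finset (Fin 4)).erase 2, #(B' k) * #(C' k) = 13 := by
    rw [e2]; simp [Finset.sum_insert, hcB', hcC', hC, hB]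
  have ha : #(A' 2) = 3 := by rw [hcA', hA]; simp
  have hb : #(B' 2) = 3 := by rw [hcB', hC]; simp
  have hvol : #(A' 2) * #(B' 2) * #(C' 2) = 27 := by rw [hcA', hcB', hcC', hA, hB, hC]; simp
  exact no_isSTPP_of_slack_one_tables_prime_card h3 h3 A' B' C' hS' hAne' hBne' hCne' 2 ⟨0, by decide⟩ ha hb hvol hz hL
    (by norm_num) (by norm_num) (by norm_num) (by norm_num) (by norm_num) (m := 15) (n := 42) rfl rfl target59_a3_b3 table59_42_15_3_a3b3
    tableAlpha59_43_17_3_a3b3 tableBeta59_43_15_3_a3b3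

/-- **`{(2,2,2),(2,2,4),(3,3,2),(3,3,2)}` has no STPP family in `ℤ/59ℤ`, PROVIDED the Hamidoune–Rødseth theorem for the stated cardinalities only** (enlarged-target
slack-1 law, reading `(a,b,c)`, block `(3, 3, 2)`: `(z, b, vol, a, L) = (18, 3, 18, 3, 18)`, tables `(38,20,3)`, α `(39,22,3)`, β `(39,20,3)`,
target `{0, 1, 58, 2, 57, 30, 29}`). [cite: CohnKleinbergSzegedyUmans2005, Def. 5.1] [cite: HamidouneRodseth2000, main theorem (§1, p. 252)] [cite: Nathanson1996, Thm 2.7] -/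
theorem no_isSTPP_zmod59_222_224_332_332_of_hrCard3 (h3 : HamidouneRodsethCard 3)
    (A B C : Fin 4 → Finset (ZMod 59)) (hS : IsSTPP A B C)
    (hA : ∀ i, #(A i) = ![2, 2, 3, 3] i) (hB : ∀ i, #(B i) = ![2, 2, 3, 3] i) (hC : ∀ i, #(C i) = ![2, 4, 2, 2] i) :
    False := by
  haveI : Fact (Nat.Prime 59) := ⟨by norm_num⟩
  have hAne : ∀ i, (A i).Nonempty := fun i => card_pos.1 (by rw [hA]; fin_cases i <;> simp)
  have hBne : ∀ i, (B i).Nonempty := fun i => card_pos.1 (by rw [hB]; fin_cases i <;> simp)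
  have hCne : ∀ i, (C i).Nonempty := fun i => card_pos.1 (by rw [hC]; fin_cases i <;> simp)
  have e2 : (univ : Finset (Fin 4)).erase 2 = {0, 1, 3} := by decide
  have hz : ∑ k ∈ (univ : Finset (Fin 4)).erase 2, #(A k) * #(C k) = 18 := by
    rw [e2]; simp [Finset.sum_insert, hA, hC]
  have hL : ∑ k ∈ (univ : Finset (Fin 4)).erase 2, #(B k) * #(C k) = 18 := by
    rw [e2]; simp [Finset.sum_insert, hB, hC]
  have ha : #(A 2) = 3 := by rw [hA]; simp
  have hb : #(B 2) = 3 := by rw [hB]; simp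
  have hvol : #(A 2) * #(B 2) * #(C 2) = 18 := by rw [hA, hB, hC]; simp
  exact no_isSTPP_of_slack_one_tables_prime_card h3 h3 A B C hS hAne hBne hCne 2 ⟨0, by decide⟩ ha hb hvol hz hL (by norm_num) (by norm_num)
    (by norm_num) (by norm_num) (by norm_num) (m := 20) (n := 38) rfl rfl target59_a3_b3 table59_38_20_3_a3b3 tableAlpha59_39_22_3_a3b3
    tableBeta59_39_20_3_a3b3

/-- **`{(2,2,3),(2,2,3),(3,3,2),(3,3,2)}` has no STPP family in `ℤ/59ℤ`, PROVIDED the Hamidoune–Rødseth theorem for the stated cardinalities only** (enlarged-target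
slack-1 law, reading `(a,b,c)`, block `(3, 3, 2)`: `(z, b, vol, a, L) = (18, 3, 18, 3, 18)`, tables `(38,20,3)`, α `(39,22,3)`, β `(39,20,3)`,
target `{0, 1, 58, 2, 57, 30, 29}`). [cite: CohnKleinbergSzegedyUmans2005, Def. 5.1] [cite: HamidouneRodseth2000, main theorem (§1, p. 252)] [cite: Nathanson1996, Thm 2.7] -/
theorem no_isSTPP_zmod59_223_223_332_332_of_hrCard3 (h3 : HamidouneRodsethCard 3)
    (A B C : Fin 4 → Finset (ZMod 59)) (hS : IsSTPP A B C)
    (hA : ∀ i, #(A i) = ![2, 2, 3, 3] i) (hB : ∀ i, #(B i) = ![2, 2, 3, 3] i) (hC : ∀ i, #(C i) = ![3, 3, 2, 2] i) :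
    False := by
  haveI : Fact (Nat.Prime 59) := ⟨by norm_num⟩
  have hAne : ∀ i, (A i).Nonempty := fun i => card_pos.1 (by rw [hA]; fin_cases i <;> simp)
  have hBne : ∀ i, (B i).Nonempty := fun i => card_pos.1 (by rw [hB]; fin_cases i <;> simp)
  have hCne : ∀ i, (C i).Nonempty := fun i => card_pos.1 (by rw [hC]; fin_cases i <;> simp)
  have e2 : (univ : Finset (Fin 4)).erase 2 = {0, 1, 3} := by decide
  have hz : ∑ k ∈ (univ : Finset (Fin 4)).erase 2, #(A k) * #(C k) = 18 := by
    rw [e2]; simp [Finset.sum_insert, hA, hC]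
  have hL : ∑ k ∈ (univ : Finset (Fin 4)).erase 2, #(B k) * #(C k) = 18 := by
    rw [e2]; simp [Finset.sum_insert, hB, hC]
  have ha : #(A 2) = 3 := by rw [hA]; simp
  have hb : #(B 2) = 3 := by rw [hB]; simp
  have hvol : #(A 2) * #(B 2) * #(C 2) = 18 := by rw [hA, hB, hC]; simp
  exact no_isSTPP_of_slack_one_tables_prime_card h3 h3 A B C hS hAne hBne hCne 2 ⟨0, by decide⟩ ha hb hvol hz hL (by norm_num) (by norm_num)
    (by norm_num) (by norm_num) (by norm_num) (m := 20) (n := 38) rfl rfl target59_a3_b3 table59_38_20_3_a3b3 tableAlpha59_39_22_3_a3b3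
    tableBeta59_39_20_3_a3b3

/-- **`{(2,2,3),(2,4,3),(2,4,3)}` has no STPP family in `ℤ/59ℤ`, PROVIDED the Hamidoune–Rødseth theorem for the stated cardinalities only** (`b = 2` slack-1 law, reading
`(b,a,c)`, i.e. for `(−B,−A,−C)`, block `(4,2,3)`: `(z, b, vol, a, L) = (18, 2, 24, 4, 12)`).
[cite: CohnKleinbergSzegedyUmans2005, Def. 5.1] [cite: HamidouneRodseth2000, main theorem (§1, p. 252)] [cite: Nathanson1996, Thm 2.7] -/
theorem no_isSTPP_zmod59_223_243_243_of_hrCard4 (h4 : HamidouneRodsethCard 4)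
    (A B C : Fin 3 → Finset (ZMod 59)) (hS : IsSTPP A B C)
    (hA : ∀ i, #(A i) = ![2, 2, 2] i) (hB : ∀ i, #(B i) = ![2, 4, 4] i) (hC : ∀ i, #(C i) = ![3, 3, 3] i) :
    False := by
  haveI : Fact (Nat.Prime 59) := ⟨by norm_num⟩
  have hAne : ∀ i, (A i).Nonempty := fun i => card_pos.1 (by rw [hA]; fin_cases i <;> simp)
  have hBne : ∀ i, (B i).Nonempty := fun i => card_pos.1 (by rw [hB]; fin_cases i <;> simp)
  have hCne : ∀ i, (C i).Nonempty := fun i => card_pos.1 (by rw [hC]; fin_cases i <;> simp)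
  -- the family (−B, −A, −C)
  set A' : Fin 3 → Finset (ZMod 59) := fun t => (B t).image Neg.neg with hA'
  set B' : Fin 3 → Finset (ZMod 59) := fun t => (A t).image Neg.neg with hB'
  set C' : Fin 3 → Finset (ZMod 59) := fun t => (C t).image Neg.neg with hC'
  have hS' : IsSTPP A' B' C' := STPP222SqNeg.isSTPP_negSwap (stpp_rotate hS)
  have hcA' : ∀ t, #(A' t) = #(B t) := fun t => Finset.card_image_of_injective _ neg_injective
  have hcB' : ∀ t, #(B' t) = #(A t) := fun t => Finset.card_image_of_injective _ neg_injective
  have hcC' : ∀ t, #(C' t) = #(C t) := fun t => Finset.card_image_of_injective _ neg_injective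
  have hAne' : ∀ t, (A' t).Nonempty := fun t => (hBne t).image _
  have hBne' : ∀ t, (B' t).Nonempty := fun t => (hAne t).image _
  have hCne' : ∀ t, (C' t).Nonempty := fun t => (hCne t).image _
  have e1 : (univ : Finset (Fin 3)).erase 1 = {0, 2} := by decide
  have hz : ∑ k ∈ (univ : Finset (Fin 3)).erase 1, #(A' k) * #(C' k) = 18 := by
    rw [e1, Finset.sum_pair (by decide)]; simp [hcA', hcC', hB, hC]
  have hL : ∑ k ∈ (univ : Finset (Fin 3)).erase 1, #(B' k) * #(C' k) = 12 := by
    rw [e1, Finset.sum_pair (by decide)]; simp [hcB', hcC', hA, hC]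
  have ha : #(A' 1) = 4 := by rw [hcA', hB]; simp
  have hb : #(B' 1) = 2 := by rw [hcB', hA]; simp
  have hvol : #(A' 1) * #(B' 1) * #(C' 1) = 24 := by rw [hcA', hcB', hcC', hA, hB, hC]; simp
  exact no_isSTPP_of_slack_one_tables_prime_b2_card h4 A' B' C' hS' hAne' hBne' hCne' 1 ⟨0, by decide⟩ ha hb hvol hz hL (by norm_num) rfl
    (by norm_num) (by norm_num) (by norm_num) (m := 15) (n := 39) rfl rfl target_59_a4_b2 table59_39_15_2_a4b2 tableAlpha59_40_17_2_a4b2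
    tableBeta2_59_39_15

/-- **`{(2,3,3),(2,3,3),(2,3,4)}` has no STPP family in `ℤ/59ℤ`, PROVIDED the Hamidoune–Rødseth theorem for the stated cardinalities only** (`b = 2` slack-1 law, reading `(c,a,b)`,
i.e. for `(C,A,B)` (`stpp_rotate` twice), block `(4,2,3)`: `(z, b, vol, a, L) = (18, 2, 24, 4, 12)`).
[cite: CohnKleinbergSzegedyUmans2005, Def. 5.1] [cite: HamidouneRodseth2000, main theorem (§1, p. 252)] [cite: Nathanson1996, Thm 2.7] -/
theorem no_isSTPP_zmod59_233_233_234_of_hrCard4 (h4 : HamidouneRodsethCard 4)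
    (A B C : Fin 3 → Finset (ZMod 59)) (hS : IsSTPP A B C)
    (hA : ∀ i, #(A i) = ![2, 2, 2] i) (hB : ∀ i, #(B i) = ![3, 3, 3] i) (hC : ∀ i, #(C i) = ![3, 3, 4] i) :
    False := by
  haveI : Fact (Nat.Prime 59) := ⟨by norm_num⟩
  have hS' : IsSTPP C A B := stpp_rotate (stpp_rotate hS)
  have hAne : ∀ i, (A i).Nonempty := fun i => card_pos.1 (by rw [hA]; fin_cases i <;> simp)
  have hBne : ∀ i, (B i).Nonempty := fun i => card_pos.1 (by rw [hB]; fin_cases i <;> simp)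
  have hCne : ∀ i, (C i).Nonempty := fun i => card_pos.1 (by rw [hC]; fin_cases i <;> simp)
  have e2 : (univ : Finset (Fin 3)).erase 2 = {0, 1} := by decide
  have hz : ∑ k ∈ (univ : Finset (Fin 3)).erase 2, #(C k) * #(B k) = 18 := by
    rw [e2, Finset.sum_pair (by decide)]; simp [hB, hC]
  have hL : ∑ k ∈ (univ : Finset (Fin 3)).erase 2, #(A k) * #(B k) = 12 := by
    rw [e2, Finset.sum_pair (by decide)]; simp [hA, hB]
  have ha : #(C 2) = 4 := by rw [hC]; simp
  have hb : #(A 2) = 2 := by rw [hA]; simp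
  have hvol : #(C 2) * #(A 2) * #(B 2) = 24 := by rw [hA, hB, hC]; simp
  exact no_isSTPP_of_slack_one_tables_prime_b2_card h4 C A B hS' hCne hAne hBne 2 ⟨0, by decide⟩ ha hb hvol hz hL (by norm_num) rfl
    (by norm_num) (by norm_num) (by norm_num) (m := 15) (n := 39) rfl rfl target_59_a4_b2 table59_39_15_2_a4b2 tableAlpha59_40_17_2_a4b2
    tableBeta2_59_39_15

end Kills

end Summit.MatrixMultiplication.OmegaCensus.CubeNB
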